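import Summits.BirchSwinnertonDyer.Rank1Residual.Additive.GordBranchPAdicGrossZagier
import Summits.BirchSwinnertonDyer.Rank1Residual.Additive.GordRankOneKatoCertificateClass
import HarnessLib

/-!
# T-O7 step 2, CONVERSE on the defect-2 rows (even branch): given the branch main conjecture
# (p07's LOWER `ChiBranchLowerDivisibilityAt` ∧ Kato's UPPER, published) and Delbourgo's (B)-clauses,
# `BSD(E,p)` in rank one IMPLIES the typed `p`-adic Gross–Zagier `BranchPAdicGrossZagierAt W p Dh` —
# so the typed input conjectures NOTHING beyond `BSD_p` + the branch IMC
# (cell `b2b-bsdres`, team n1011, seat p01, OWNERS row T-O7; sequel of `GordBranchPAdicGrossZagier.lean`)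

HONEST FRAMING (cell `b2b-bsdres`, run/shared/lean/b2b/bsd-rank1-residual/, verbatim in every
file): prove what is provable now; shrink each hard class to its core with data; no claim beyond
stated classes. Research routes; census output = EVIDENCE / conjecture items, never a Literature
fact; RESIDUAL-MAP marks change only by signed lines. §I O7 stays OPEN; X4♯(G-ord) stays
CONSTRUCTION-SHAPED; nothing is booked; no label changes. COVERAGE (stated first, referee 1
proviso): the DEFECT-2 rows `E = V ⊗ χ_p`, `V = E♭` good ordinary, `p ≡ 1 (mod 4)`, `p ≥ 5`, `ρ̄_{E,p}`
SURJECTIVE (Kato's image hypothesis, lifted to the tower by Serre), `E` of analytic rank `1`,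
non-anomalous (Delbourgo's `ℓ_p = 1`); the (B)-clauses `LeadingTermClauses W p Dh` are the A175
binder's output (p ≥ 5, non-CM). NO definition, NO Literature fact minted, NO `_holds`; theorems only.

## What (the loop closes)

`GordBranchPAdicGrossZagier.lean` proved `ChiBranchLowerDivisibilityAt ∧ BranchPAdicGrossZagierAt ⟹
CycLowerBoundAt ⟹ MissingLowerBoundAt` (with A175 + rider). HERE the converse:

* §1 `Λ`-algebra (`exists_unit_coeff_one_eq_of_lower_of_upper`): if `ι fE = ι h · G` (lower) and
  `ι (k·fE) = C(u)·G`, `u ∈ ℤ_p^×` (upper: `G ∈ u⁻¹·char`), with `fE(0) = 0 ≠ [T¹] fE`, then `G(0) = 0`,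
  `h(0) ∈ ℤ_p^×` and `[T¹] G = h(0)⁻¹ · [T¹] fE`.
* §2 `branchPAdicGrossZagierAt_of_bsdp_of_chiBranchLower_of_kato`: `BSDp W p` (Miller) ∧ the
  (B)-clauses for `Dh` ∧ the Schneider rider ∧ `ℓ_p = 1` ∧ p07's `ChiBranchLowerDivisibilityAt W p` ∧
  Kato 2004 Thm. 17.4 (3) on the component (`hK`, PUBLISHED, via additive-p2's
  `isTorsion_and_exists_iota_eq_branch_of_katoComponent`) ∧ `Surj W p`, `p ≥ 5` ⟹
  `BranchPAdicGrossZagierAt W p Dh` in analytic rank `1`. Proof: (B) gives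
  `[T¹]fE·log_p γ·#T² = u_B·#Ш[p^∞]·Reg_p·Tam` and `fE(0) = 0`; §1 gives `ϖ[T¹]B = h(0)⁻¹[T¹]fE`;
  `BSD(E,p)` says `#Ш_an/#Ш[p^∞] ∈ ℤ_p^×`; so `ϖ·[T¹]B·log_p γ = (h(0)⁻¹·u_B·#Ш[p^∞]/#Ш_an)·q·Reg_p`
  with `q = #Ш_an·Tam/#T²`, `L'(E,1) = q·Ω_E·Reg_∞`. NO Birch / Pal / GZK binder is used.
So on X4♯(G-ord) ∩ `I₀*` ∩ surj, `p ≡ 1 (mod 4)`, `p ≥ 5`, rank one, GIVEN the branch IMC (our LOWER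
conjecture + Kato) and A175: the typed `p`-adic Gross–Zagier is EQUIVALENT to the `p`-part of BSD —
it is EXACTLY the missing analytic input, not a stronger conjecture.

References: [Delbourgo2002] Thm. (B) (p. 40); [Kato2004Asterisque] Thm. 17.4 (3); [Miller2011LMS]
Def. 1.1; [MazurTateTeitelbaum1986Invent] §I.13–I.14; [GreenbergLNM1716] §5.
-/

noncomputable section

open scoped Classical MatrixGroups ModularForm NumberField

open CongruenceSubgroup WeierstrassCurve NumberField Literature.NumberTheory.EllipticCurves
  Literature.NumberTheory.EllipticCurves.ModularForms
  Literature.NumberTheory.EllipticCurves.Rank1Residual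
  Literature.NumberTheory.EllipticCurves.Rank1Residual.Typed
  Literature.NumberTheory.EllipticCurves.Delbourgo2002
  Literature.NumberTheory.GaloisRepresentations
  IsDedekindDomain

namespace Summit.BirchSwinnertonDyer.Rank1Residual.Additive

variable (W : WeierstrassCurve ℚ) [W.IsElliptic] [W.IsGloballyMinimal] (p : ℕ) [hp : Fact p.Prime]

/-! ### §1 `Λ`-algebra: lower ∧ upper on the branch pin the linear coefficient -/

omit [W.IsGloballyMinimal] in
variable {W} in
/-- **Lower ∧ upper pin `[T¹]`.** In `ℚ_p⟦T⟧`, if `ι fE = ι h · G` and `ι(k · fE) = C(u) · G` with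
`u ∈ ℤ_p^×`, `fE(0) = 0` and `[T¹] fE ≠ 0`, then `[T¹] G = w · [T¹] fE` for a unit `w ∈ ℤ_p^×`
(`w = h(0)⁻¹`; indeed `G(0) = 0`, `[T¹]fE = h(0)[T¹]G`, `u[T¹]G = k(0)[T¹]fE`, so `k(0)h(0) = u`).
[cite: Washington1997, §7.1 (Λ = ℤ_p⟦T⟧ bookkeeping; folklore)] -/
theorem exists_unit_coeff_one_eq_of_lower_of_upper {fE h k : IwasawaAlgebra p}
    {G : PowerSeries ℚ_[p]} {u : ℤ_[p]ˣ}
    (hlow : iwasawaToPowerSeries p fE = iwasawaToPowerSeries p h * G)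
    (hup : iwasawaToPowerSeries p (k * fE) = PowerSeries.C ((u : ℤ_[p]) : ℚ_[p]) * G)
    (h0 : PowerSeries.constantCoeff fE = 0) (h1 : PowerSeries.coeff 1 fE ≠ 0) :
    ∃ w : ℤ_[p]ˣ, PowerSeries.coeff 1 G =
      ((w : ℤ_[p]) : ℚ_[p]) * ((PowerSeries.coeff 1 fE : ℤ_[p]) : ℚ_[p]) := by
  have hu0 : ((u : ℤ_[p]) : ℚ_[p]) ≠ 0 := coe_units_ne_zero p u
  -- `G(0) = 0`
  have hG0 : PowerSeries.constantCoeff G = 0 := by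
    have h : ((u : ℤ_[p]) : ℚ_[p]) * PowerSeries.constantCoeff G = 0 := by
      calc ((u : ℤ_[p]) : ℚ_[p]) * PowerSeries.constantCoeff G
          = PowerSeries.constantCoeff (PowerSeries.C ((u : ℤ_[p]) : ℚ_[p]) * G) := by
            rw [map_mul, PowerSeries.constantCoeff_C]
        _ = PowerSeries.constantCoeff (iwasawaToPowerSeries p (k * fE)) := by rw [hup]
        _ = 0 := by
            rw [constantCoeff_iwasawaToPowerSeries, map_mul, h0, mul_zero, PadicInt.coe_zero]
    exact (mul_eq_zero.mp h).resolve_left hu0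
  -- `[T¹] fE = h(0) · [T¹] G`
  have hfE1 : ((PowerSeries.coeff 1 fE : ℤ_[p]) : ℚ_[p]) =
      ((PowerSeries.constantCoeff h : ℤ_[p]) : ℚ_[p]) * PowerSeries.coeff 1 G := by
    rw [← Wuthrich2014.coeff_iwasawaToPowerSeries p fE 1, hlow,
      coeff_one_mul_of_constantCoeff_eq_zero p _ _ hG0, constantCoeff_iwasawaToPowerSeries]
  -- `u · [T¹] G = k(0) · [T¹] fE`
  have hιfE0 : PowerSeries.constantCoeff (iwasawaToPowerSeries p fE) = 0 := by
    rw [constantCoeff_iwasawaToPowerSeries, h0, PadicInt.coe_zero]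
  have hG1 : ((u : ℤ_[p]) : ℚ_[p]) * PowerSeries.coeff 1 G =
      ((PowerSeries.constantCoeff k : ℤ_[p]) : ℚ_[p]) * ((PowerSeries.coeff 1 fE : ℤ_[p]) : ℚ_[p]) := by
    rw [← PowerSeries.coeff_C_mul, ← hup, map_mul, coeff_one_mul_of_constantCoeff_eq_zero p _ _ hιfE0,
      constantCoeff_iwasawaToPowerSeries, Wuthrich2014.coeff_iwasawaToPowerSeries]
  -- `[T¹] G ≠ 0`, `k(0) h(0) = u`, `h(0)` a unit
  have hG1ne : PowerSeries.coeff 1 G ≠ 0 := by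
    intro hz
    apply h1
    rw [hz, mul_zero] at hfE1
    exact PadicInt.coe_eq_zero.mp hfE1
  have hprod : PowerSeries.constantCoeff k * PowerSeries.constantCoeff h = (u : ℤ_[p]) := by
    have h : ((((PowerSeries.constantCoeff k * PowerSeries.constantCoeff h : ℤ_[p])) : ℚ_[p]) -
        ((u : ℤ_[p]) : ℚ_[p])) * PowerSeries.coeff 1 G = 0 := by
      rw [PadicInt.coe_mul, sub_mul, mul_assoc, ← hfE1, ← hG1, sub_self]
    have h' := sub_eq_zero.mp ((mul_eq_zero.mp h).resolve_right hG1ne)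
    exact Subtype.ext h'
  have hunit : IsUnit (PowerSeries.constantCoeff h) := by
    have hu : IsUnit (PowerSeries.constantCoeff k * PowerSeries.constantCoeff h) := by
      rw [hprod]; exact Units.isUnit u
    exact isUnit_of_mul_isUnit_right hu
  -- `[T¹] G = h(0)⁻¹ · [T¹] fE`
  have hh0 : ((PowerSeries.constantCoeff h : ℤ_[p]) : ℚ_[p]) ≠ 0 := fun hz ↦
    hunit.ne_zero (PadicInt.coe_eq_zero.mp hz)
  have hinv : (((hunit.unit⁻¹ : ℤ_[p]ˣ) : ℤ_[p]) : ℚ_[p]) =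
      (((PowerSeries.constantCoeff h : ℤ_[p]) : ℚ_[p]))⁻¹ := by
    have h2 : ((hunit.unit⁻¹ : ℤ_[p]ˣ) : ℤ_[p]) * PowerSeries.constantCoeff h = 1 := by
      have h3 := hunit.unit.inv_mul
      rwa [IsUnit.unit_spec] at h3
    have h : (((hunit.unit⁻¹ : ℤ_[p]ˣ) : ℤ_[p]) : ℚ_[p]) *
        ((PowerSeries.constantCoeff h : ℤ_[p]) : ℚ_[p]) = 1 := by
      rw [← PadicInt.coe_mul, h2, PadicInt.coe_one]
    exact eq_inv_of_mul_eq_one_left h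
  refine ⟨hunit.unit⁻¹, ?_⟩
  rw [hinv, hfE1, ← mul_assoc, inv_mul_cancel₀ hh0, one_mul]

/-! ### §2 The converse: `BSD(E,p)` ∧ branch IMC ∧ (B)-clauses ⟹ the typed `p`-adic Gross–Zagier -/

omit [W.IsGloballyMinimal] in
variable {W p} in
/-- **CONVERSE (defect 2, even branch, rank one).** Let `W` be globally minimal, `p ≡ 1 (mod 4)`,
`p ≥ 5`, `ρ̄_{E,p}` surjective, `E` potentially good ordinary of type (G) (`TypeGOrd`), of analytic
rank `1`, non-anomalous, and `Dh` a height datum with Delbourgo's (B)-clauses and `Reg_p(E,Dh) ≠ 0`.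
IF `BSD(E,p)` holds (Miller), p07's LOWER branch input `ChiBranchLowerDivisibilityAt W p` holds and
Kato's component divisibility (`hK`, Kato 2004 Thm. 17.4 (3), PUBLISHED) is granted, THEN
`BranchPAdicGrossZagierAt W p Dh`: for every admissible `(V, C, f, ϖ)`,
`ϖ·[T¹]B·log_p γ = u·q·Reg_p(E,Dh)` with `u ∈ ℤ_p^×`, `q = #Ш_an·Tam/#T²`. With
`GordBranchPAdicGrossZagier.lean` (forward direction) this makes the typed `p`-adic Gross–Zagier
EQUIVALENT to `BSD_p` on these rows modulo the branch IMC and A175 — nothing stronger is conjectured.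
Binders: `hK` (published), modularity `hmod` (for `L'(E,1) ≠ 0`); NO Birch/Pal/GZK.
[cite: Delbourgo2002, Theorem (B) (p. 40)] [cite: Kato2004Asterisque, Thm. 17.4 (3) (p. 273)]
[cite: Miller2011LMS, Def. 1.1] [cite: GreenbergLNM1716, §5 (PDF p. 143)] -/
theorem branchPAdicGrossZagierAt_of_bsdp_of_chiBranchLower_of_kato
    (hK : Kato2004.charIdeal_dvd_padicLFunctionBranch_component_of_surjective)
    (hmod : hasEntireLFunction_rat) {Dh : PAdicHeightData W p}
    (hB : LeadingTermClauses W p Dh) (hS : SchneiderConjecture Dh) (hna : ReductionNonAnomalous W p)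
    (hG : TypeGOrd W p) (hsurj : Surj W p) (hp5 : 5 ≤ p) (hr : W.analyticRank = 1) (hbsd : BSDp W p)
    (hdiv : ChiBranchLowerDivisibilityAt W p) : BranchPAdicGrossZagierAt W p Dh := by
  intro V _ _ N _ f hp4 hVW hord hf ϖ hϖ
  have hpP : p.Prime := hp.out
  have hp2 : p ≠ 2 := by omega
  have heven : Even (p / 2) := ⟨p / 4, by omega⟩
  obtain ⟨hrank, hfinp, s, hs, hvs⟩ := hbsd
  have hmw : W.mordellWeilRank = 1 := by rw [hrank, hr]
  obtain ⟨C, hC⟩ := hVW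
  have hC' : C • V.quadraticTwist ((-1 : ℚ) ^ (p / 2) * p) = W := by
    rw [pStar_eq_self_of_mod_four_eq_one hp4]; exact hC
  -- the cyclotomic setting, a dual datum, a generator of `char_Λ X(E/ℚ_∞)`
  obtain ⟨κ, hκ, γ, hγ, hγ'⟩ := exists_isCyclotomic_isTopGenerator_isCyclotomicVariable_holds p
  obtain ⟨D⟩ := W.nonempty_selmerDualData_holds κ γ hγ
  haveI : Module.Finite (IwasawaAlgebra p) D.X := D.module_finite_holds hγ
  haveI : (Literature.NumberTheory.EllipticCurves.Module.charIdeal (IwasawaAlgebra p) D.X).IsPrincipal :=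
    charIdeal_isPrincipal_holds p D.X
  obtain ⟨fE, hchar⟩ := Submodule.IsPrincipal.principal
    (Literature.NumberTheory.EllipticCurves.Module.charIdeal (IwasawaAlgebra p) D.X)
  have hchar' : D.charIdeal = Ideal.span {fE} := hchar
  -- UPPER (Kato on the component, full series): `ι g = C(u·ϖ)·B` for some `g ∈ char`
  have hsurjV : ∀ n : ℕ, V.HasSurjectiveModNGaloisRep (p ^ n : ℕ) :=
    X4RankZeroTwistOdd.forall_surj_pow_twist_of_surj W p hp5 V (pStar_ne_zero p) C hC' hsurj
  have hϖ' : (if Even (p / 2) then (ϖ : ℝ) * V.realPeriodRat = plusPeriod f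
      else (ϖ : ℝ) * V.imaginaryPeriodRat = minusPeriod f) := by
    rw [if_pos heven]; exact hϖ
  obtain ⟨hXt, g, hg, u, hι⟩ := isTorsion_and_exists_iota_eq_branch_of_katoComponent W p hK
    (padicValRat_j_nonneg_of_typeGOrd W p hG) hp2 V ⟨C, hC'⟩ (Or.inl hord) hsurjV hκ hγ hγ' hf D ϖ hϖ'
  rw [if_pos heven] at hι
  set B := padicLFunctionBranch f ((unitRoot V p : ℤ_[p]) : ℚ_[p]) (p / 2) with hB_def
  set G : PowerSeries ℚ_[p] := PowerSeries.C ((ϖ : ℚ) : ℚ_[p]) * B with hG_def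
  have hgspan : g ∈ Ideal.span {fE} := by rw [← hchar']; exact hg
  obtain ⟨k, hk⟩ := Ideal.mem_span_singleton'.mp hgspan
  have hup : iwasawaToPowerSeries p (k * fE) = PowerSeries.C ((u : ℤ_[p]) : ℚ_[p]) * G := by
    rw [hk, hι, hG_def, ← mul_assoc, ← map_mul]
  -- LOWER (p07's typed input): `ι fE = ι h · G`
  obtain ⟨h, hlow⟩ := hdiv V hp4 ⟨C, hC⟩ hord hκ hγ hγ' hf D ϖ hϖ fE
    (by rw [hchar']; exact Ideal.mem_span_singleton_self fE)
  -- (B): `fE(0) = 0` and the exact leading term (ℓ = 1)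
  have hord1 : (W.mordellWeilRank : ℕ∞) ≤ fE.order := (hB κ γ hκ hγ hγ' D hXt fE hchar').1
  have h0 : PowerSeries.constantCoeff fE = 0 := by
    rw [← PowerSeries.coeff_zero_eq_constantCoeff_apply]
    refine PowerSeries.coeff_of_lt_order 0 ?_
    rw [hmw, Nat.cast_one] at hord1
    exact lt_of_lt_of_le (by exact_mod_cast zero_lt_one) hord1
  obtain ⟨uB, hBeq⟩ := hB.leadingCoeff_of_nonAnomalous hκ hγ hγ' D hXt hchar' hS hfinp hna
  rw [hmw, pow_one] at hBeq
  -- positivity / non-vanishing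
  have hT0 : W.torsionOrder ≠ 0 := (W.torsionOrder_pos_holds).ne'
  have hTQ : (W.torsionOrder : ℚ_[p]) ≠ 0 := by exact_mod_cast hT0
  have hT2Q : (W.torsionOrder : ℚ_[p]) ^ 2 ≠ 0 := pow_ne_zero 2 hTQ
  have hPpos : 0 < W.tamagawaProduct := W.tamagawaProduct_pos_holds
  have hCQ : (W.tamagawaProduct : ℚ_[p]) ≠ 0 := by exact_mod_cast hPpos.ne'
  have hShp0 : (Nat.card (AddCommGroup.primaryComponent W.sha p) : ℚ_[p]) ≠ 0 := by
    exact_mod_cast Nat.card_pos.ne'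
  have huB0 : ((uB : ℤ_[p]) : ℚ_[p]) ≠ 0 := coe_units_ne_zero p uB
  have hRegp : padicRegulator Dh ≠ 0 := hS
  have hlog : padicLog p (cyclotomicGenerator p : ℚ_[p]) ≠ 0 := by
    obtain ⟨uγ, huγ⟩ := exists_unit_padicLog_cyclotomicGenerator p hp2
    rw [huγ]
    exact mul_ne_zero (Nat.cast_ne_zero.mpr hpP.ne_zero) (coe_units_ne_zero p uγ)
  have h1 : PowerSeries.coeff 1 fE ≠ 0 := by
    intro hz
    rw [hz, PadicInt.coe_zero, zero_mul, zero_mul] at hBeq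
    exact mul_ne_zero huB0 (mul_ne_zero (mul_ne_zero hShp0 hRegp) hCQ) hBeq.symm
  -- §1: `[T¹] G = w · [T¹] fE`, `w ∈ ℤ_p^×`
  obtain ⟨w, hw⟩ := exists_unit_coeff_one_eq_of_lower_of_upper p hlow hup h0 h1
  -- the rational `q` (definition of the analytic Ш)
  have hΩpos : 0 < W.realPeriodRat := W.realPeriodRat_pos_holds
  have hRegpos : 0 < W.regulator := regulator_pos_holds W
  set q : ℚ := s * (W.tamagawaProduct : ℚ) / (W.torsionOrder : ℚ) ^ 2 with hq_def
  have hlead : W.leadingLCoeff = (q : ℂ) * (W.realPeriodRat : ℂ) * (W.regulator : ℂ) := by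
    have hΩC : (W.realPeriodRat : ℂ) ≠ 0 := by exact_mod_cast hΩpos.ne'
    have hRegC : (W.regulator : ℂ) ≠ 0 := by exact_mod_cast hRegpos.ne'
    have hTC : (W.torsionOrder : ℂ) ≠ 0 := by exact_mod_cast hT0
    have hPC : (W.tamagawaProduct : ℂ) ≠ 0 := by exact_mod_cast hPpos.ne'
    have h := hs
    rw [shaAn_def] at h
    rw [hq_def]
    push_cast
    rw [div_eq_iff (mul_ne_zero (mul_ne_zero hΩC hPC) hRegC)] at h
    field_simp
    linear_combination h
  have hL0 : W.leadingLCoeff ≠ 0 := W.leadingLCoeff_ne_zero_holds (hmod W)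
  have hs0 : s ≠ 0 := by
    intro hz
    apply hL0
    rw [hlead, hq_def, hz]
    simp
  -- the unit `#Ш[p^∞] / #Ш_an` — this is where `BSD(E,p)` enters
  have hsQ : ((s : ℚ) : ℚ_[p]) ≠ 0 := by exact_mod_cast hs0
  set t : ℚ_[p] := (Nat.card (AddCommGroup.primaryComponent W.sha p) : ℚ_[p]) / ((s : ℚ) : ℚ_[p])
    with ht_def
  have hnorm : ‖t‖ = 1 := by
    have hnS : ‖(Nat.card (AddCommGroup.primaryComponent W.sha p) : ℚ_[p])‖ = ‖((s : ℚ) : ℚ_[p])‖ := by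
      rw [Padic.norm_eq_zpow_neg_valuation hShp0, Padic.norm_eq_zpow_neg_valuation hsQ,
        Padic.valuation_natCast, Padic.valuation_ratCast, hvs]
    rw [ht_def, norm_div, hnS, div_self (norm_ne_zero_iff.mpr hsQ)]
  obtain ⟨wS, hwS⟩ := exists_unit_coe_eq_of_norm_eq_one p hnorm
  -- assemble
  refine ⟨w * uB * wS, q, hlead, ?_⟩
  have hG1 : PowerSeries.coeff 1 G = ((ϖ : ℚ) : ℚ_[p]) * PowerSeries.coeff 1 B := by
    rw [hG_def, PowerSeries.coeff_C_mul]
  have hf1 : ((PowerSeries.coeff 1 fE : ℤ_[p]) : ℚ_[p]) =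
      ((uB : ℤ_[p]) : ℚ_[p]) *
          ((Nat.card (AddCommGroup.primaryComponent W.sha p) : ℚ_[p]) * padicRegulator Dh *
            W.tamagawaProduct) /
        (padicLog p (cyclotomicGenerator p : ℚ_[p]) * (W.torsionOrder : ℚ_[p]) ^ 2) := by
    rw [eq_div_iff (mul_ne_zero hlog hT2Q), ← hBeq]
    ring
  rw [hmw, pow_one, ← hG1, hw, Units.val_mul, Units.val_mul, PadicInt.coe_mul, PadicInt.coe_mul, hwS,
    ht_def, hq_def, hf1]
  push_cast
  field_simp

omit [W.IsGloballyMinimal] in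
variable {W p} in
/-- **Class form: X4♯(G-ord) ∩ `I₀*` ∩ {`ρ̄_{E,p}` onto}, `p ≡ 1 (mod 4)` inside the predicate, `p ≥ 5`,
`r_an = 1`, non-anomalous.** For every height datum with Delbourgo's (B)-clauses and the rider:
`BSD(E,p)` ∧ p07's LOWER branch input ∧ Kato (published) ⟹ `BranchPAdicGrossZagierAt W p Dh` — the
converse of `ClassX4Gord.missingLowerBoundAt_rankOne_of_chiBranchLower_of_branchPAdicGrossZagier`.
X4♯(G-ord) stays CONSTRUCTION-SHAPED; nothing booked. [cite: Delbourgo2002, Theorem (B) (p. 40)]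
[cite: Kato2004Asterisque, Thm. 17.4 (3) (p. 273)] [cite: Miller2011LMS, Def. 1.1] -/
theorem ClassX4Gord.branchPAdicGrossZagierAt_of_bsdp_of_chiBranchLower_of_kato
    (hK : Kato2004.charIdeal_dvd_padicLFunctionBranch_component_of_surjective)
    (hmod : hasEntireLFunction_rat) (hX : ClassX4Gord W p) (hsurj : Surj W p) (hp5 : 5 ≤ p)
    (hr : W.analyticRank = 1) (hna : ReductionNonAnomalous W p) (hbsd : BSDp W p)
    (hdiv : ChiBranchLowerDivisibilityAt W p) {Dh : PAdicHeightData W p}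
    (hB : LeadingTermClauses W p Dh) (hS : SchneiderConjecture Dh) : BranchPAdicGrossZagierAt W p Dh :=
  Additive.branchPAdicGrossZagierAt_of_bsdp_of_chiBranchLower_of_kato hK hmod hB hS hna hX.typeGOrd hsurj
    hp5 hr hbsd hdiv

end Summit.BirchSwinnertonDyer.Rank1Residual.Additive

end
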